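/-
Origin: expansion seat `planner-pub-hodgecm-pv15-0`, handover v5 2026-08-18T04:00:35Z (`HOME/pub-hodgecm-pv15/lean/Pv15/PseudoEisenstein.lean`, md5 e245767c, 762 lines);
landed by the gen-5 packager in gate run 20 REPLACES the earlier landed copy of `HodgeCM/PerL34/PseudoEisenstein.lean` (verbatim).
-/
/-
Origin: HOME/pub-hodgecm-pv15/lean/Pv15/PseudoEisenstein.lean — session planner-pub-hodgecm-pv15-0
(unit pub-hodgecm-pv15, DAG-NODE PROVER #15).  Intended final place: `HodgeCM/PerL34/PseudoEisenstein.lean`.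
DAG node N23a (HOME/LEMMAS.md §1/§5): PerL v5 Proposition 3.6 (`prop:isol`) proof, Step 0, tex ll. 405–411,
plus the UNFOLDING identity used in Step 1 (ll. 413–417, node N23b) and Step 2 (ll. 424–425, node N23c).
Pure Mathlib.  No placeholders.
-/
import Mathlib

/-!
# PerL v5 Prop. 3.6, Step 0: the pseudo-Eisenstein series `E^χ_f` and the unfolding identity

Verbatim node (tex ll. 405–411): for a character `χ` of `[T]` and `f ∈ C_c^∞(U(W)(𝔸))` put
`Ξ^χ_f(y) := ∫_{T(𝔸)} f(t⁻¹y) χ(t) dt`; then `Ξ^χ_f(ty) = χ(t) Ξ^χ_f(y)`, `Ξ^χ_f` is smooth and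
compactly supported modulo `T(𝔸)`, and `E^χ_f(y) := Σ_{γ ∈ T(L₀)\U(W)(L₀)} Ξ^χ_f(γy)` is a locally
finite sum (`U(W)(L₀)` discrete in `U(W)(𝔸)`, `T(L₀)\T(𝔸)` compact) defining a smooth function on
`[U(W)]`; since `R(h₀)E^χ_f = E^χ_{f^{h₀}}`, `f^{h₀}(x) = f(xh₀)`, the closure of the span `𝓔` is
`R(U(W)(𝔸))`-invariant.

Step 1 display (ll. 415–417): `𝒯_Φ(E^χ_f)(g) = ∫_{T(L₀)\U(W)(𝔸)} θ_Φ(g,y) Ξ^χ_f(y) dy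
  = ∫_{U(W)(𝔸)} f(h) ∫_{[T]} θ_Φ(g,th) χ(t) dt dh = ∫_{U(W)(𝔸)} f(h) ϑ_{T,χ}(ω(h)Φ)(g) dh`.
Step 2 display (ll. 424–425): `⟨E^χ_f, v⟩ = ∫_{U(W)(𝔸)} f(h) conj(P_{T,χ̄}(R(h)v)) dh`.

## The model (abstract harmonic analysis; no adelic vocabulary is needed for these steps)

* `G` — a locally compact Hausdorff topological group with a LEFT-invariant Radon measure `μ`
  (stands for `U(W)(𝔸)`); `Γ ≤ G` a countable subgroup (stands for `U(W)(L₀)`), "discrete" in the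
  sense used at l. 408: it meets every compact set in a finite set (hypothesis `DiscreteMeets`);
  `[U(W)] = Γ\G` is realised by a measurable fundamental domain `𝓕` for the left action of `Γ`
  (Mathlib `MeasureTheory.IsFundamentalDomain Γ 𝓕 μ`); integrals over `[U(W)]` of left-`Γ`-invariant
  functions are `∫ y in 𝓕, … ∂μ` (independent of `𝓕`: `IsFundamentalDomain.setIntegral_eq`).
* `T` — a topological group with a measure `ν` (stands for `T(𝔸)` with its Haar measure), mapped into
  `G` by a continuous homomorphism `jT : T →* G`; `χ : T → ℂ` continuous.
* `[T] = T(L₀)\T(𝔸)` compact is realised by a continuous compactly supported weight `β : T → ℝ`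
  (a `T(L₀)`-partition of unity, `Σ_δ β(δt) = 1`, which exists exactly because the quotient is compact —
  Bourbaki, Intégration VII §2 n°3; Weil's formula): `∫_{[T]} F := ∫_T β F dν` for left-`T(L₀)`-invariant
  `F`.  Only the two properties "continuous" and "compactly supported" of `β` are used below; the
  normalisation `Σ_δ β(δt) = 1` is what identifies `∫_T β F dν` with the quotient integral and
  `Σ_{γ∈Γ} Ξ_β(γy)` with PerL's `Σ_{γ ∈ T(L₀)\U(W)(L₀)} Ξ(γy)` (see `Xi_equivariant` and the remark after
  `Eis`).
* `K : G → ℂ` continuous and left-`Γ`-invariant — the two instances used by PerL are `K = θ_Φ(g, ·)`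
  (Step 1; continuity l. 393) and `K = conj ∘ v`, `v` a smooth vector (Step 2; "smooth vectors are
  continuous functions on `[U(W)]`", l. 391).

## Results (all kernel-checked, pure Mathlib)

* `Xi_equivariant` : `Ξ^χ_f(jT(s) y) = χ(s) Ξ^χ_f(y)` (l. 407), for `ν` left-invariant and `χ` multiplicative.
* `Xiβ_rTrans`, `Eis_rTrans` : `E^χ_{f^{h₀}}(y) = E^χ_f(y h₀)`, i.e. `R(h₀)E^χ_f = E^χ_{f^{h₀}}` (l. 410) —
  this is the carver's `N23a_pseudoEisenstein` (translation law) in the function model.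
* `Eis_leftInvariant` : `E^χ_f` is left-`Γ`-invariant (a function on `[U(W)]`).
* `Eis_support_finite` : for every `y` only finitely many `γ ∈ Γ` contribute ("locally finite sum", l. 408),
  from `DiscreteMeets Γ` and compact supports.
* `continuous_Xiβ`, `hasCompactSupport_Xiβ` : `Ξ_β ∈ C_c(G)`.
* `unfolding` : `∫_{𝓕} E^χ_f(y) K(y) dμ = ∫_G f(h) (∫_T β(t)χ(t) K(jT(t) h) dν) dμ` — the common
  unfolding behind ll. 415–417 and 424–425; corollaries `unfolding_theta` (Step 1 display, given the
  equivariance `θ_Φ(g,th) = θ_{ω(h)Φ}(g,t)` of l. 414) and `unfolding_inner` (Step 2 display).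
* `continuous_Eis` : `E^χ_f` is continuous on `G` (locally a finite sum of translates of `Ξ_β`,
  ll. 408–409; `G` locally compact).
* `Xi_eq_tsum_Xiβ`, `Eis_eq_cosetSum` (fidelity): PerL's full torus integral is the
  `T(L₀)`-periodisation of `Ξ_β`, and PerL's coset sum `Σ_{γ ∈ T(L₀)\U(W)(L₀)} Ξ^χ_f(γy)` (over any
  system of coset representatives) EQUALS `Eis` — so every result here is about PerL's `E^χ_f` itself.
* `closureSpan_invariant` : a continuous linear operator mapping a set `S` into itself preserves the
  closure of its span (with `Eis_rTrans`: `𝓔̄` is `R(U(W)(𝔸))`-invariant, ll. 410–411).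
* `eq_zero_of_forall_integral_mul_eq_zero` (fundamental lemma of the calculus of variations,
  continuous form, for any measure charging open sets) and `toricPeriod_transl_eq_zero_of_orthogonal` :
  Step 2's consequence form (ll. 423–426) — `v ⊥ E^χ_f` for all `f ∈ C_c` ⇒ the toric period of
  EVERY right translate `R(h)v` vanishes (`continuous_toricPeriod_conj` = "continuous", l. 426).

Print inputs: none beyond Mathlib (Fubini for compactly supported continuous integrands
`MeasureTheory.integral_integral_swap_of_hasCompactSupport`, the unfolding over a fundamental domain
`MeasureTheory.IsFundamentalDomain.integral_eq_tsum''`, left invariance `MeasureTheory.integral_mul_left_eq_self`).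
-/

set_option autoImplicit false

noncomputable section

open MeasureTheory Set Filter Function
open scoped Pointwise ENNReal

namespace HodgeCM
namespace PerL34
namespace N23a

/-! ## Definitions (explicit binders: each object carries exactly the structure it needs) -/

/-- The weight `β(t) χ(t)` realising `χ(t) dt` on `[T]`. -/
def wt {T : Type*} (β : T → ℝ) (χ : T → ℂ) (t : T) : ℂ := (β t : ℂ) * χ t

/-- PerL's `Ξ^χ_f(y) := ∫_{T(𝔸)} f(t⁻¹ y) χ(t) dt` (tex l. 406), the full torus integral. -/
def Xi {G T : Type*} [Group G] [Group T] [MeasurableSpace T]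
    (ν : Measure T) (jT : T →* G) (χ : T → ℂ) (f : G → ℂ) (y : G) : ℂ :=
  ∫ t, χ t * f ((jT t)⁻¹ * y) ∂ν

/-- The `β`-truncated toric transform `Ξ_β(y) := ∫_T β(t) χ(t) f(t⁻¹ y) dν(t)`; summing it over the
FULL group `Γ` gives PerL's sum of `Ξ^χ_f` over the cosets `T(L₀)\U(W)(L₀)` (when `Σ_δ β(δt) = 1`). -/
def Xiβ {G T : Type*} [Group G] [Group T] [MeasurableSpace T]
    (ν : Measure T) (jT : T →* G) (β : T → ℝ) (χ : T → ℂ) (f : G → ℂ) (y : G) : ℂ :=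
  ∫ t, wt β χ t * f ((jT t)⁻¹ * y) ∂ν

/-- The pseudo-Eisenstein series `E^χ_f(y) = Σ_{γ ∈ Γ} Ξ_β(γ y)` (tex l. 408), a left-`Γ`-invariant
function on `G`, i.e. a function on `[U(W)] = Γ\G`. -/
def Eis {G T : Type*} [Group G] [Group T] [MeasurableSpace T]
    (ν : Measure T) (jT : T →* G) (β : T → ℝ) (χ : T → ℂ) (Γ : Subgroup G) (f : G → ℂ)
    (y : G) : ℂ :=
  ∑' γ : Γ, Xiβ ν jT β χ f ((γ : G) * y)

/-- The toric period of a function `K` on `G` along the `T`-orbit through `h`: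
`P(K)(h) := ∫_{[T]} K(t h) χ(t) dt`, realised as `∫_T β(t) χ(t) K(jT(t) h) dν(t)`. -/
def toricPeriod {G T : Type*} [Group G] [Group T] [MeasurableSpace T]
    (ν : Measure T) (jT : T →* G) (β : T → ℝ) (χ : T → ℂ) (K : G → ℂ) (h : G) : ℂ :=
  ∫ t, wt β χ t * K (jT t * h) ∂ν

/-- Right translate `f^{h₀}(x) := f(x h₀)` (tex l. 410). -/
def rTrans {G : Type*} [Group G] (f : G → ℂ) (h₀ : G) : G → ℂ := fun x => f (x * h₀)

/-- "`Γ` is discrete in `G`" in the form used at tex l. 408: `Γ` meets every compact set of `G` in a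
finite set. -/
def DiscreteMeets {G : Type*} [Group G] [TopologicalSpace G] (Γ : Subgroup G) : Prop :=
  ∀ C : Set G, IsCompact C → {γ : Γ | (γ : G) ∈ C}.Finite

/-! ## Step 0: equivariance, translation law, invariance, local finiteness -/

section Step0

variable {G : Type*} [Group G] {T : Type*} [Group T] [MeasurableSpace T]

/-- `Ξ^χ_f(t y) = χ(t) Ξ^χ_f(y)` (tex l. 407). -/
theorem Xi_equivariant [MeasurableMul T] (ν : Measure T) [ν.IsMulLeftInvariant] (jT : T →* G)
    (χ : T → ℂ)
    (hχ : ∀ s t, χ (s * t) = χ s * χ t) (f : G → ℂ) (s : T) (y : G) :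
    Xi ν jT χ f (jT s * y) = χ s * Xi ν jT χ f y := by
  unfold Xi
  have h1 : ∀ t, χ t * f ((jT t)⁻¹ * (jT s * y))
      = χ s * (χ (s⁻¹ * t) * f ((jT (s⁻¹ * t))⁻¹ * y)) := by
    intro t
    have e1 : (jT (s⁻¹ * t))⁻¹ * y = (jT t)⁻¹ * (jT s * y) := by
      simp only [map_mul, map_inv, mul_inv_rev, inv_inv, mul_assoc]
    have e2 : χ s * χ (s⁻¹ * t) = χ t := by rw [← hχ, mul_inv_cancel_left]
    rw [e1, ← e2]
    ring
  simp_rw [h1]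
  rw [integral_const_mul]
  congr 1
  exact integral_mul_left_eq_self (fun t => χ t * f ((jT t)⁻¹ * y)) s⁻¹

/-- `Ξ_β` of the right translate: `Ξ_β(f^{h₀})(y) = Ξ_β(f)(y h₀)`. -/
theorem Xiβ_rTrans (ν : Measure T) (jT : T →* G) (β : T → ℝ) (χ : T → ℂ) (f : G → ℂ)
    (h₀ y : G) : Xiβ ν jT β χ (rTrans f h₀) y = Xiβ ν jT β χ f (y * h₀) := by
  simp only [Xiβ, rTrans, mul_assoc]

/-- **N23a, translation law** (tex l. 410): `E^χ_{f^{h₀}}(y) = E^χ_f(y h₀)`, i.e.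
`R(h₀) E^χ_f = E^χ_{f^{h₀}}` for the right regular representation `(R(h₀)u)(y) = u(y h₀)`. -/
theorem Eis_rTrans (ν : Measure T) (jT : T →* G) (β : T → ℝ) (χ : T → ℂ) (Γ : Subgroup G)
    (f : G → ℂ) (h₀ y : G) :
    Eis ν jT β χ Γ (rTrans f h₀) y = Eis ν jT β χ Γ f (y * h₀) := by
  simp only [Eis, Xiβ_rTrans, mul_assoc]

/-- `E^χ_f` is left-`Γ`-invariant: it is a function on `[U(W)] = Γ\G`. -/
theorem Eis_leftInvariant (ν : Measure T) (jT : T →* G) (β : T → ℝ) (χ : T → ℂ) (Γ : Subgroup G)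
    (f : G → ℂ) (γ₀ : Γ) (y : G) :
    Eis ν jT β χ Γ f ((γ₀ : G) * y) = Eis ν jT β χ Γ f y := by
  unfold Eis
  have := (Equiv.mulRight γ₀).tsum_eq (fun γ : Γ => Xiβ ν jT β χ f ((γ : G) * y))
  simpa only [Equiv.coe_mulRight, Subgroup.coe_mul, mul_assoc] using this

/-- Vanishing of `Ξ_β` off the compact set `jT(tsupport β) · tsupport f`. -/
theorem Xiβ_eq_zero_of_notMem [TopologicalSpace G] [TopologicalSpace T] (ν : Measure T) (jT : T →* G) (β : T → ℝ) (χ : T → ℂ) (f : G → ℂ)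
    {z : G} (hz : z ∉ ((jT : T → G) '' tsupport β) * tsupport f) :
    Xiβ ν jT β χ f z = 0 := by
  unfold Xiβ
  have hzero : ∀ t, wt β χ t * f ((jT t)⁻¹ * z) = 0 := by
    intro t
    by_cases ht : t ∈ tsupport β
    · have hf0 : f ((jT t)⁻¹ * z) = 0 := by
        apply image_eq_zero_of_notMem_tsupport
        intro hmem
        apply hz
        refine Set.mem_mul.mpr ⟨jT t, Set.mem_image_of_mem _ ht, (jT t)⁻¹ * z, hmem, ?_⟩
        simp
      rw [hf0, mul_zero]
    · have hb : β t = 0 := image_eq_zero_of_notMem_tsupport ht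
      simp [wt, hb]
  simp_rw [hzero]
  simp

/-- **N23a, local finiteness** (tex l. 408): for each `y` only finitely many `γ ∈ Γ` contribute to
`E^χ_f(y)`, because `Γ` meets compact sets in finite sets and `Ξ_β` is supported in the compact set
`jT(tsupport β) · tsupport f`. -/
theorem Eis_support_finite [TopologicalSpace G] [IsTopologicalGroup G] [T2Space G]
    [TopologicalSpace T] (ν : Measure T) (jT : T →* G) (hjT : Continuous jT)
    (β : T → ℝ) (hβs : HasCompactSupport β) (χ : T → ℂ) (Γ : Subgroup G) (hΓ : DiscreteMeets Γ)
    (f : G → ℂ) (hfs : HasCompactSupport f) (y : G) :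
    (Function.support fun γ : Γ => Xiβ ν jT β χ f ((γ : G) * y)).Finite := by
  set C : Set G := ((jT : T → G) '' tsupport β) * tsupport f with hC
  have hCc : IsCompact C := (hβs.isCompact.image hjT).mul hfs.isCompact
  have hC' : IsCompact ((fun x : G => x * y⁻¹) '' C) := hCc.image (continuous_id.mul continuous_const)
  refine (hΓ _ hC').subset ?_
  intro γ hγ
  have hmem : (γ : G) * y ∈ C := by
    by_contra h
    exact hγ (Xiβ_eq_zero_of_notMem ν jT β χ f h)
  exact ⟨(γ : G) * y, hmem, by simp⟩

end Step0

/-! ## Regularity of `Ξ_β` -/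

section Regularity

variable {G : Type*} [Group G] [TopologicalSpace G] [IsTopologicalGroup G]
  {T : Type*} [Group T] [TopologicalSpace T] [MeasurableSpace T]

omit [Group T] [MeasurableSpace T] in
/-- (Ported verbatim from the HodgeCMPerL package; no docstring in the source.) -/
theorem continuous_wt {β : T → ℝ} (hβ : Continuous β) {χ : T → ℂ} (hχ : Continuous χ) :
    Continuous (wt β χ) :=
  (Complex.continuous_ofReal.comp hβ).mul hχ

omit [Group T] [MeasurableSpace T] in
/-- (Ported verbatim from the HodgeCMPerL package; no docstring in the source.) -/
theorem wt_eq_zero_of_notMem (β : T → ℝ) (χ : T → ℂ) {t : T} (ht : t ∉ tsupport β) :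
    wt β χ t = 0 := by
  have hb : β t = 0 := image_eq_zero_of_notMem_tsupport ht
  simp [wt, hb]

/-- `Ξ_β` is continuous (a parametric integral of a continuous, uniformly compactly supported kernel). -/
theorem continuous_Xiβ [OpensMeasurableSpace T] (ν : Measure T) [IsFiniteMeasureOnCompacts ν] (jT : T →* G) (hjT : Continuous jT)
    (β : T → ℝ) (hβ : Continuous β) (hβs : HasCompactSupport β) (χ : T → ℂ) (hχ : Continuous χ)
    (f : G → ℂ) (hf : Continuous f) : Continuous (Xiβ ν jT β χ f) := by
  have hk : IsCompact (tsupport β) := hβs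
  have hF : ContinuousOn
      (Function.uncurry fun (y : G) (t : T) => wt β χ t * f ((jT t)⁻¹ * y)) (univ ×ˢ univ) := by
    apply Continuous.continuousOn
    change Continuous fun p : G × T => wt β χ p.2 * f ((jT p.2)⁻¹ * p.1)
    exact ((continuous_wt hβ hχ).comp continuous_snd).mul
      (hf.comp (((hjT.comp continuous_snd).inv).mul continuous_fst))
  have hzero : ∀ (p : G) (t : T), p ∈ (univ : Set G) → t ∉ tsupport β →
      (fun (y : G) (t : T) => wt β χ t * f ((jT t)⁻¹ * y)) p t = 0 := by
    intro p t _ ht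
    simp only [wt_eq_zero_of_notMem β χ ht, zero_mul]
  have h := continuousOn_integral_of_compact_support (μ := ν) hk hF hzero
  exact continuousOn_univ.mp h

/-- `Ξ_β` has compact support, contained in `jT(tsupport β) · tsupport f`. -/
theorem hasCompactSupport_Xiβ [T2Space G] (ν : Measure T) (jT : T →* G) (hjT : Continuous jT)
    (β : T → ℝ) (hβs : HasCompactSupport β) (χ : T → ℂ) (f : G → ℂ) (hfs : HasCompactSupport f) :
    HasCompactSupport (Xiβ ν jT β χ f) := by
  apply HasCompactSupport.intro ((hβs.isCompact.image hjT).mul hfs.isCompact)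
  intro z hz
  exact Xiβ_eq_zero_of_notMem ν jT β χ f hz

/-- **`E^χ_f` is continuous** (tex ll. 408–409: the locally finite sum defines a (smooth) function —
here: continuous): on a compact neighbourhood `C` of any point only the finitely many `γ ∈ Γ` with
`γ ∈ (jT(tsupport β)·tsupport f)·C⁻¹` contribute, so `E^χ_f` is locally a finite sum of translates
of the continuous `Ξ_β`.  Needs `G` locally compact (true for `U(W)(𝔸)`). -/
theorem continuous_Eis [T2Space G] [LocallyCompactSpace G] [OpensMeasurableSpace T]
    (ν : Measure T) [IsFiniteMeasureOnCompacts ν] (jT : T →* G) (hjT : Continuous jT)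
    (β : T → ℝ) (hβ : Continuous β) (hβs : HasCompactSupport β) (χ : T → ℂ) (hχ : Continuous χ)
    (Γ : Subgroup G) (hΓ : DiscreteMeets Γ)
    (f : G → ℂ) (hf : Continuous f) (hfs : HasCompactSupport f) :
    Continuous (Eis ν jT β χ Γ f) := by
  rw [continuous_iff_continuousAt]
  intro y₀
  obtain ⟨C, hC, hCy⟩ := exists_compact_mem_nhds y₀
  set S : Set G := ((jT : T → G) '' tsupport β) * tsupport f with hSdef
  have hS : IsCompact S := (hβs.isCompact.image hjT).mul hfs.isCompact
  have hfin : {γ : Γ | (γ : G) ∈ S * C⁻¹}.Finite := hΓ _ (hS.mul hC.inv)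
  have heq : ∀ y ∈ C,
      Eis ν jT β χ Γ f y = ∑ γ ∈ hfin.toFinset, Xiβ ν jT β χ f ((γ : G) * y) := by
    intro y hy
    unfold Eis
    apply tsum_eq_sum
    intro γ hγ
    apply Xiβ_eq_zero_of_notMem
    intro hmem
    apply hγ
    rw [Set.Finite.mem_toFinset]
    show (γ : G) ∈ S * C⁻¹
    exact Set.mem_mul.2 ⟨(γ : G) * y, hmem, y⁻¹, Set.inv_mem_inv.2 hy, mul_inv_cancel_right _ _⟩
  have hcont : ContinuousOn
      (fun y => ∑ γ ∈ hfin.toFinset, Xiβ ν jT β χ f ((γ : G) * y)) C := by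
    apply Continuous.continuousOn
    apply continuous_finsetSum
    intro γ _
    exact (continuous_Xiβ ν jT hjT β hβ hβs χ hχ f hf).comp (continuous_const.mul continuous_id)
  exact (hcont.congr fun y hy => heq y hy).continuousAt hCy

end Regularity

/-! ## The unfolding identity -/

section Unfolding

variable {G : Type*} [Group G] [TopologicalSpace G] [IsTopologicalGroup G] [T2Space G]
  [MeasurableSpace G] [BorelSpace G]
  {T : Type*} [Group T] [TopologicalSpace T] [T2Space T] [MeasurableSpace T] [OpensMeasurableSpace T]


-- port_pkg: scope closed for this part
end Unfolding
end N23a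
end PerL34
end HodgeCM
end
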